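import Summits.PneNP.PneNP.Theorems.Sd2BlMachineDictCount
import Summits.PneNP.PneNP.Theorems.Sd2BlMachineDictGraph
import Summits.PneNP.PneNP.Theorems.Sd2BlMachineRawLegsDict

/-!
# K1'' machine side (S3), DICTIONARY D1i: the certificate legs `CLeg c` on the machine's pieces

Cell pnp-ideate, ROUND-18 item K1'' (split with pnp-ideate-prover-2 g13).  The generic dictionary D1 / D1b / D1c
(`Sd2BlMachineDict{Pieces,Graph,Count}`) speaks of POSITIONS in a raw-leg list; the interface
`SignDeg2Legs.sigCertified_of_legBound` and the closer speak of the certificate legs `E = SignDeg2Legs.CLeg c`.  With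
prover-2's records (`Sd2BlMachineRawLegsDict`: `rawOf I c e`, `rawOf_lv / _rv`, `rawOf_injective`, `mem_rawLegs_iff`,
`nodup_rawLegs`, under the coefficient-table hypothesis `hF`) this file transports everything to `CLeg c`, for the raw
legs `rawI = rawLegs k F0 F1 F2 (decode k I.encode)` of the code of `I`:

* `posOf e : Fin rawI.length` — the position of `rawOf e` (a BIJECTION: `posOf_injective`, `posOf_surjective`);
  `srcI / dstI e` := the pieces of that position; **`own₁G_srcI` / `own₂G_dstI`**: their decoded owners ARE
  `srcOwner I e.out e.kind` / `dstOwner I c e.out e.kind` (the `hsrc / hdst` of `sigCertified_of_legBound`);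
* degrees `card_filter_srcI_le / dstI_le ≤ L` (the `hdeg₁ / hdeg₂` of `Sd2Bl.legBound_of_pipeline`);
* `length_rawI = |CLeg c|`, owner codes `< 2n + 2`, hence the piece count **`card_piecesI_le_real`**:
  `|α| + |β| ≤ 8n + 2ℓm/L` when every output has `≤ ℓ` legs and `n ≥ 1` (`hN`), and `one_le_card_piecesI` (`hN1`);
* the leg relation of `CLeg c` is the leg relation of positions (`exists_leg_iff`), so the connectivity dictionary
  holds verbatim for `E = CLeg c` (`connected_pipelineI_iff_connected_labels`).

Restricted-model algorithmic infrastructure; nothing here bears on `P` versus `NP`.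
-/

set_option linter.dupNamespace false -- `Summit.PneNP.PneNP.…`: summit = sub-problem name (D-0017 single-conjunct layout)

namespace Summit.PneNP.PneNP.Theorems.Sd2BlMachine

open Literature.Computability.Complexity
open Summit.PneNP.PneNP.Theorems.SfmBlMachine (Lab PLeg labL labR pieces pieceGraph)
open Summit.PneNP.PneNP.Theorems.SfmBl (bipGraph)
open Summit.PneNP.PneNP.Theorems.SignRepCertificate (Cert)
open Summit.PneNP.PneNP.Theorems.SignDeg2Legs (Kind coef CLeg srcOwner dstOwner)
open Summit.PneNP.PneNP.Theorems.LocalMapDecodeFP (decode)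

variable {k n m : ℕ} (I : LocalMap k n m) (c : Cert I)
  (F0 : ((Fin k → Bool) → Bool) → ℤ) (F1 : ((Fin k → Bool) → Bool) → Fin k → ℤ)
  (F2 : ((Fin k → Bool) → Bool) → Fin k → Fin k → ℤ)

/-- The raw legs of the code of `I` for the tables `F0, F1, F2`. -/
noncomputable abbrev rawI : List RLeg := rawLegs k F0 F1 F2 (decode k I.encode)

/-- Decoding prover-2's owner code recovers the owner. -/
theorem ownerOfCode_ownerCode' (o : Option (Fin n) × Bool) : ownerOfCode n (ownerCode o) = o := by
  obtain ⟨_ | v, b⟩ := o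
  · have e : ownerCode ((none : Option (Fin n)), b) = b.toNat := by cases b <;> rfl
    rw [e, ownerOfCode_const]
  · have e : ownerCode (some v, b) = 2 * (v.val + 1) + b.toNat := by cases b <;> rfl
    rw [e, ownerOfCode_vertex]

/-- Owner codes are `< 2n + 2`. -/
theorem ownerCode_lt (o : Option (Fin n) × Bool) : ownerCode o < 2 * n + 2 := by
  obtain ⟨v, b⟩ := o
  have hv : (v.elim 0 fun w : Fin n => w.val + 1) ≤ n := by
    cases v with
    | none => exact Nat.zero_le _
    | some w => exact w.isLt
  have hb : (if b then 1 else 0) ≤ 1 := by cases b <;> simp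
  show 2 * (v.elim 0 fun w : Fin n => w.val + 1) + (if b then 1 else 0) < 2 * n + 2
  omega

section WithF

variable (hF : ∀ (j : Fin m) (κ : Kind k), coef c j κ = coefF k F0 F1 F2 (I.table j) κ)
include hF

/-- Every raw leg of the code is the raw leg of a certificate leg. -/
theorem exists_rawOf_eq (i : Fin (rawI I F0 F1 F2).length) : ∃ e : CLeg c, rawOf I c e = (rawI I F0 F1 F2)[i.val] :=
  (mem_rawLegs_iff I c F0 F1 F2 hF _).1 (List.getElem_mem _)

/-- The raw leg of a certificate leg is in the list. -/
theorem rawOf_mem (e : CLeg c) : rawOf I c e ∈ rawI I F0 F1 F2 := (mem_rawLegs_iff I c F0 F1 F2 hF _).2 ⟨e, rfl⟩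

/-- THE POSITION of a certificate leg in the machine's raw-leg list. -/
noncomputable def posOf (e : CLeg c) : Fin (rawI I F0 F1 F2).length :=
  ⟨(rawI I F0 F1 F2).idxOf (rawOf I c e), List.idxOf_lt_length_iff.2 (rawOf_mem I c F0 F1 F2 hF e)⟩

/-- The raw leg at the position of `e` is `rawOf e`. -/
theorem getElem_posOf (e : CLeg c) : (rawI I F0 F1 F2)[(posOf I c F0 F1 F2 hF e).val] = rawOf I c e := by
  unfold posOf
  exact List.getElem_idxOf (List.idxOf_lt_length_iff.2 (rawOf_mem I c F0 F1 F2 hF e))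

/-- `posOf` is injective. -/
theorem posOf_injective : Function.Injective (posOf I c F0 F1 F2 hF) := by
  intro e e' h
  apply rawOf_injective I c
  rw [← getElem_posOf I c F0 F1 F2 hF e, ← getElem_posOf I c F0 F1 F2 hF e']
  simp only [h]

/-- `posOf` is surjective. -/
theorem posOf_surjective : Function.Surjective (posOf I c F0 F1 F2 hF) := by
  intro i
  obtain ⟨e, he⟩ := exists_rawOf_eq I c F0 F1 F2 hF i
  refine ⟨e, Fin.ext ?_⟩
  show (rawI I F0 F1 F2).idxOf (rawOf I c e) = i.val
  rw [he]
  exact (nodup_rawLegs I F0 F1 F2).idxOf_getElem i.val i.isLt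

/-- The raw-leg list enumerates `CLeg c`. -/
theorem length_rawI : (rawI I F0 F1 F2).length = Fintype.card (CLeg c) := by
  have h := Fintype.card_of_bijective ⟨posOf_injective I c F0 F1 F2 hF, posOf_surjective I c F0 F1 F2 hF⟩
  rw [Fintype.card_fin] at h
  exact h.symm

variable (L : ℕ)

/-- The left piece of a certificate leg. -/
noncomputable def srcI (e : CLeg c) : LPieceG L (rawI I F0 F1 F2) := srcG L (rawI I F0 F1 F2) (posOf I c F0 F1 F2 hF e)

/-- The right piece of a certificate leg. -/
noncomputable def dstI (e : CLeg c) : RPieceG L (rawI I F0 F1 F2) := dstG L (rawI I F0 F1 F2) (posOf I c F0 F1 F2 hF e)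

/-- **`hsrc`**: the left piece of leg `e` is owned by `srcOwner I e.out e.kind`. -/
theorem own₁G_srcI (e : CLeg c) : own₁G L (rawI I F0 F1 F2) n (srcI I c F0 F1 F2 hF L e) = srcOwner I e.out e.kind := by
  unfold srcI
  rw [own₁G_srcG, getElem_posOf I c F0 F1 F2 hF e, rawOf_lv, ownerOfCode_ownerCode']

/-- **`hdst`**: the right piece of leg `e` is owned by `dstOwner I c e.out e.kind`. -/
theorem own₂G_dstI (e : CLeg c) : own₂G L (rawI I F0 F1 F2) n (dstI I c F0 F1 F2 hF L e) = dstOwner I c e.out e.kind := by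
  unfold dstI
  rw [own₂G_dstG, getElem_posOf I c F0 F1 F2 hF e, rawOf_rv, ownerOfCode_ownerCode']

/-- **`hdeg₁`**: every left piece carries at most `L` certificate legs. -/
theorem card_filter_srcI_le {L : ℕ} (hL : 0 < L) (P : LPieceG L (rawI I F0 F1 F2)) :
    (Finset.univ.filter fun e => srcI I c F0 F1 F2 hF L e = P).card ≤ L := by
  classical
  refine le_trans ?_ (card_filter_srcG_le hL (rawI I F0 F1 F2) P)
  refine Finset.card_le_card_of_injOn (posOf I c F0 F1 F2 hF) (fun e he => ?_)
    (fun a _ b _ h => posOf_injective I c F0 F1 F2 hF h)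
  rw [Finset.mem_coe, Finset.mem_filter] at he ⊢
  exact ⟨Finset.mem_univ _, he.2⟩

/-- **`hdeg₂`**: every right piece carries at most `L` certificate legs. -/
theorem card_filter_dstI_le {L : ℕ} (hL : 0 < L) (Q : RPieceG L (rawI I F0 F1 F2)) :
    (Finset.univ.filter fun e => dstI I c F0 F1 F2 hF L e = Q).card ≤ L := by
  classical
  refine le_trans ?_ (card_filter_dstG_le hL (rawI I F0 F1 F2) Q)
  refine Finset.card_le_card_of_injOn (posOf I c F0 F1 F2 hF) (fun e he => ?_)
    (fun a _ b _ h => posOf_injective I c F0 F1 F2 hF h)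
  rw [Finset.mem_coe, Finset.mem_filter] at he ⊢
  exact ⟨Finset.mem_univ _, he.2⟩

/-! ## Piece counts -/

/-- Left owner codes of the raw legs are `< 2n + 2`. -/
theorem lvertG_rawI_lt (i : ℕ) (hi : i < (rawI I F0 F1 F2).length) : lvertG (rawI I F0 F1 F2) i < 2 * n + 2 := by
  obtain ⟨e, he⟩ := exists_rawOf_eq I c F0 F1 F2 hF ⟨i, hi⟩
  rw [lvertG_eq _ i hi, ← he, rawOf_lv]
  exact ownerCode_lt _

/-- Right owner codes of the raw legs are `< 2n + 2`. -/
theorem rvertG_rawI_lt (i : ℕ) (hi : i < (rawI I F0 F1 F2).length) : rvertG (rawI I F0 F1 F2) i < 2 * n + 2 := by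
  obtain ⟨e, he⟩ := exists_rawOf_eq I c F0 F1 F2 hF ⟨i, hi⟩
  rw [rvertG_eq _ i hi, ← he, rawOf_rv]
  exact ownerCode_lt _

omit hF in
/-- With at most `ℓ` legs per output there are at most `ℓ·m` certificate legs. -/
theorem card_CLeg_le {ℓ : ℕ} (hℓ : ∀ j : Fin m, (Finset.univ.filter fun e : CLeg c => e.out = j).card ≤ ℓ) :
    Fintype.card (CLeg c) ≤ ℓ * m := by
  classical
  have h := Finset.card_eq_sum_card_fiberwise (s := (Finset.univ : Finset (CLeg c))) (t := Finset.univ)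
    (f := fun e : CLeg c => e.out) (fun _ _ => Finset.mem_univ _)
  rw [Finset.card_univ] at h
  rw [h]
  calc ∑ j : Fin m, (Finset.univ.filter fun e : CLeg c => e.out = j).card ≤ ∑ _j : Fin m, ℓ :=
        Finset.sum_le_sum fun j _ => hℓ j
    _ = ℓ * m := by rw [Finset.sum_const, Finset.card_univ, Fintype.card_fin, smul_eq_mul, mul_comm]

/-- **`hN`**: `|α| + |β| ≤ 8n + 2ℓm/L` for the machine's pieces, when every output has `≤ ℓ` legs and `n ≥ 1`. -/
theorem card_piecesI_le_real {L ℓ : ℕ} (hL : 0 < L) (hn : 0 < n)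
    (hℓ : ∀ j : Fin m, (Finset.univ.filter fun e : CLeg c => e.out = j).card ≤ ℓ) :
    ((Fintype.card (LPieceG L (rawI I F0 F1 F2)) : ℝ) + Fintype.card (RPieceG L (rawI I F0 F1 F2)))
      ≤ 8 * n + 2 * ℓ * m / (L : ℝ) := by
  have h := card_piecesG_le_real hL (rawI I F0 F1 F2) (lvertG_rawI_lt I c F0 F1 F2 hF) (rvertG_rawI_lt I c F0 F1 F2 hF)
  have hlen : ((rawI I F0 F1 F2).length : ℝ) ≤ ℓ * m := by
    rw [length_rawI I c F0 F1 F2 hF]; exact_mod_cast card_CLeg_le I c hℓ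
  have hn' : (1 : ℝ) ≤ n := by exact_mod_cast hn
  have hL' : (0 : ℝ) < L := by exact_mod_cast hL
  have hdiv : 2 * ((rawI I F0 F1 F2).length : ℝ) / L ≤ 2 * ℓ * m / (L : ℝ) := by
    rw [div_le_div_iff_of_pos_right hL']; nlinarith
  push_cast at h
  linarith

/-- **`hN1`**: with at least one certificate leg there is at least one piece. -/
theorem one_le_card_piecesI [hE : Nonempty (CLeg c)] :
    1 ≤ Fintype.card (LPieceG L (rawI I F0 F1 F2)) + Fintype.card (RPieceG L (rawI I F0 F1 F2)) := by
  obtain ⟨e⟩ := hE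
  exact one_le_card_piecesG L _ (by rw [length_rawI I c F0 F1 F2 hF]; exact Fintype.card_pos_iff.2 ⟨e⟩)

/-! ## Connectivity over `CLeg c` -/

/-- The leg relation of the certificate legs is the leg relation of the positions. -/
theorem exists_leg_iff (i : LPieceG L (rawI I F0 F1 F2)) (q : RPieceG L (rawI I F0 F1 F2)) :
    (∃ e : CLeg c, srcI I c F0 F1 F2 hF L e = i ∧ dstI I c F0 F1 F2 hF L e = q) ↔
      ∃ p : Fin (rawI I F0 F1 F2).length, srcG L _ p = i ∧ dstG L _ p = q := by
  constructor
  · rintro ⟨e, h1, h2⟩; exact ⟨posOf I c F0 F1 F2 hF e, h1, h2⟩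
  · rintro ⟨p, h1, h2⟩
    obtain ⟨e, rfl⟩ := posOf_surjective I c F0 F1 F2 hF p
    exact ⟨e, h1, h2⟩

/-- **CONNECTIVITY DICTIONARY over `CLeg c`**: a pair `(W₁, W₂)` of pieces is connected for the certificate legs' relation
iff its label set is connected in the machine's piece graph. -/
theorem connected_pipelineI_iff_connected_labels (W₁ : Finset (LPieceG L (rawI I F0 F1 F2)))
    (W₂ : Finset (RPieceG L (rawI I F0 F1 F2))) :
    ((bipGraph (fun i q => ∃ e : CLeg c, srcI I c F0 F1 F2 hF L e = i ∧ dstI I c F0 F1 F2 hF L e = q)).induce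
        {x | Sum.elim (fun i => i ∈ W₁) (fun q => q ∈ W₂) x}).Connected
      ↔ ((pieceGraph (pieceLegsG L (rawI I F0 F1 F2))).induce (labelsOfG W₁ W₂ : Set Lab)).Connected := by
  have e : (fun i q => ∃ e : CLeg c, srcI I c F0 F1 F2 hF L e = i ∧ dstI I c F0 F1 F2 hF L e = q) =
      (fun i q => ∃ p : Fin (rawI I F0 F1 F2).length, srcG L _ p = i ∧ dstG L _ p = q) := by
    funext i q; exact propext (exists_leg_iff I c F0 F1 F2 hF L i q)
  rw [e]
  exact connected_pipelineG_iff_connected_labels W₁ W₂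

end WithF

end Summit.PneNP.PneNP.Theorems.Sd2BlMachine
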